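import Literature.Computability.MetaComplexity.BoundedArithStandardModel
import Literature.Computability.MetaComplexity.BoundedArithS2Blocks
import HarnessLib

/-!
# The `S₂¹` bootstrapping functions in the standard model `ℕ`

Topic `Literature/Computability/MetaComplexity`.  The functions of the `S₂¹` tier
(`BoundedArithS2Div.lean`, `BoundedArithS2Blocks.lean`: `pw`, `msp`, `lsp`, `blk`, `parity`,
`bit`) are defined in an arbitrary structure `M ⊨ BASIC + Σᵇ₁-PIND` by their `Σᵇ₁` specifications.
The standard model `ℕ` is such a structure (`model_nat_BASIC_holds`, `model_nat_PINDScheme`,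
`BoundedArithStandardModel.lean`), and there the specifications pin the functions down to ordinary
arithmetic: `pw S k = 2 ^ min k |S|`, `msp S a k = a / 2 ^ min k |S|`, `lsp S a k = a % 2 ^ min k |S|`,
`blk`, `parity x = x % 2` (Buss 1986, §§2.4–2.5, intended meaning of `MSP`, `LSP`, `Bit`).  This is
the bridge by which the value in `ℕ` of a uniformly `Σᵇ₁`-defined function
(`BoundedArithS2Graphs.lean`) is computed.

## Design note

The algebraic type-class instances of the namespace `BASICModel` (`LinearOrder M`, `CommSemiring M`,
… for `[M ⊨ BASIC]`) would, on `ℕ`, duplicate Mathlib's; therefore `ℕ ⊨ BASIC` and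
`ℕ ⊨ Σᵇ₁-PIND` are registered here as *local* instances only, the statements are written in
Mathlib's vocabulary, and the (definitionally equal but syntactically different) instance forms are
bridged by `change` / the lemmas `le_model_iff`, `lt_model_iff`, `min_model`.  The instance
attributes die at `end NatModel`; downstream files re-enable them with
`attribute [local instance] NatModel.instModelNatBASIC NatModel.instModelNatPIND`.

## References

* S. R. Buss, *Bounded Arithmetic*, Bibliopolis 1986, §§2.4–2.5.
-/

namespace Literature.Computability.MetaComplexity

open FirstOrder FirstOrder.Language

namespace NatModel

/-- `ℕ ⊨ BASIC` as a local instance (`model_nat_BASIC_holds`). [cite: Buss1986, §2.2] -/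
local instance instModelNatBASIC : ℕ ⊨ BASIC := model_nat_BASIC_holds

/-- `ℕ ⊨ Σᵇ₁-PIND` as a local instance (`model_nat_PINDScheme`). [cite: Buss1986, §2.4] -/
local instance instModelNatPIND : ℕ ⊨ PINDScheme (sigmabFormulas 1) := model_nat_PINDScheme _

/-! ## Bridging the instance forms -/

/-- The order of the `BASICModel` instances on `ℕ` is the order of `ℕ`. [folklore] -/
theorem le_model_iff (a b : ℕ) : @LE.le ℕ (BASICModel.instLinearOrder (M := ℕ)).toLE a b ↔ a ≤ b :=
  Iff.rfl

/-- The strict order of the `BASICModel` instances on `ℕ` is the strict order of `ℕ`. [folklore] -/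
theorem lt_model_iff (a b : ℕ) : @LT.lt ℕ (BASICModel.instLinearOrder (M := ℕ)).toLT a b ↔ a < b := by
  rw [@lt_iff_le_not_ge ℕ (BASICModel.instLinearOrder (M := ℕ)).toPreorder, le_model_iff,
    le_model_iff]
  omega

/-- The `min` of the `BASICModel` order on `ℕ` is `Nat.min`. [folklore] -/
theorem min_model (a b : ℕ) : @min ℕ (BASICModel.instLinearOrder (M := ℕ)).toMin a b = min a b := by
  rw [@min_def ℕ (BASICModel.instLinearOrder (M := ℕ)), Nat.min_def]
  simp only [le_model_iff]

/-- `mLen` on `ℕ` is `Nat.size`. [folklore] -/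
theorem mLen_eq (n : ℕ) : mLen n = n.size := rfl

/-! ## Powers of two -/

/-- `|2ʲ - 1| = j` (a private copy of `PVFun.size_two_pow_sub_one`, `PVTables.lean`, which is
not importable here without pulling in the PV development). [folklore] -/
private theorem size_two_pow_sub_one (j : ℕ) : Nat.size (2 ^ j - 1) = j := by
  refine le_antisymm (Nat.size_le.2 (Nat.sub_lt (Nat.two_pow_pos j) Nat.one_pos)) ?_
  rcases j with _ | j
  · simp
  · refine (Nat.lt_size).2 ?_ |> fun h => h
    have : 2 ^ j ≤ 2 ^ (j + 1) - 1 := by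
      have := Nat.two_pow_pos j; rw [pow_succ]; omega
    exact this

/-- **`IsPow` in `ℕ`**: `y` is a power of two iff `y = 2ʲ` for some `j` (Krajíček 1995, p. 75:
`Pow(a)`). [cite: Krajicek1995, §5.4 (p. 75)] -/
theorem isPow_iff {y : ℕ} : BASICModel.IsPow (M := ℕ) y ↔ ∃ j, y = 2 ^ j := by
  change (∃ x, x ≤ y ∧ (x + 1 = y ∧ Nat.size x + 1 = Nat.size y)) ↔ _
  constructor
  · rintro ⟨x, -, rfl, hlen⟩
    refine ⟨Nat.size x, ?_⟩
    have h1 : x < 2 ^ Nat.size x := Nat.lt_size_self x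
    have h2 : 2 ^ Nat.size x ≤ x + 1 := Nat.lt_size.1 (by omega)
    omega
  · rintro ⟨j, rfl⟩
    refine ⟨2 ^ j - 1, Nat.sub_le _ _, Nat.sub_add_cancel (Nat.two_pow_pos j), ?_⟩
    rw [size_two_pow_sub_one, Nat.size_pow]

/-- **`pw` in `ℕ`**: `pw S k = 2 ^ min k |S|` (Buss 1986, §2.4: `2^{min(k,|S|)}`). [cite: Buss1986, §2.4] -/
theorem pw_eq (S k : ℕ) : BASICModel.pw (M := ℕ) S k = 2 ^ min k S.size := by
  have h := (BASICModel.eq_pw_iff (M := ℕ) (S := S) (k := k) (y := 2 ^ min k S.size)).2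
    ⟨isPow_iff.2 ⟨_, rfl⟩, ?_⟩
  · exact h.symm
  · rw [min_model]
    change Nat.size (2 ^ min k S.size) = min k S.size + 1
    exact Nat.size_pow

/-! ## `msp`, `lsp`, `blk`, `parity`, `bit` -/

/-- **`msp` and `lsp` in `ℕ`**: quotient and remainder by `2 ^ min k |S|` (Buss 1986, §2.5: `MSP`,
`LSP`). [cite: Buss1986, §2.5] -/
theorem msp_eq_and_lsp_eq (S a k : ℕ) :
    BASICModel.msp (M := ℕ) S a k = a / 2 ^ min k S.size ∧
      BASICModel.lsp (M := ℕ) S a k = a % 2 ^ min k S.size := by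
  have h := BASICModel.eq_msp_and_eq_lsp (M := ℕ) (S := S) (a := a) (k := k)
    (q := a / 2 ^ min k S.size) (r := a % 2 ^ min k S.size) ?_ ?_
  · exact ⟨h.1.symm, h.2.symm⟩
  · rw [pw_eq]
    exact (Nat.div_add_mod' a _).symm
  · rw [pw_eq, lt_model_iff]
    exact Nat.mod_lt _ (Nat.two_pow_pos _)

/-- `msp S a k = a / 2 ^ min k |S|`. [cite: Buss1986, §2.5] -/
theorem msp_eq (S a k : ℕ) : BASICModel.msp (M := ℕ) S a k = a / 2 ^ min k S.size :=
  (msp_eq_and_lsp_eq S a k).1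

/-- `lsp S a k = a % 2 ^ min k |S|`. [cite: Buss1986, §2.5] -/
theorem lsp_eq (S a k : ℕ) : BASICModel.lsp (M := ℕ) S a k = a % 2 ^ min k S.size :=
  (msp_eq_and_lsp_eq S a k).2

/-- **`blk` in `ℕ`**: `blk S w i B = w / 2 ^ min (i·B) |S| % 2 ^ min B |S|`. [cite: Buss1986, §2.5] -/
theorem blk_eq (S w i B : ℕ) :
    BASICModel.blk (M := ℕ) S w i B = w / 2 ^ min (i * B) S.size % 2 ^ min B S.size := by
  unfold BASICModel.blk
  rw [lsp_eq, msp_eq]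
  rfl

/-- **`parity` in `ℕ`**: `parity x = x % 2`. [cite: Buss1986, §2.4] -/
theorem parity_eq (x : ℕ) : BASICModel.parity (M := ℕ) x = x % 2 := by
  unfold BASICModel.parity
  split_ifs with h
  · change 2 * (x / 2) = x at h
    change (0 : ℕ) = x % 2
    omega
  · change ¬2 * (x / 2) = x at h
    change (1 : ℕ) = x % 2
    omega

/-- **`bit` in `ℕ`**: `bit S a k = a / 2 ^ min k |S| % 2`. [cite: Buss1986, §2.5] -/
theorem bit_eq (S a k : ℕ) : BASICModel.bit (M := ℕ) S a k = a / 2 ^ min k S.size % 2 := by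
  unfold BASICModel.bit
  rw [parity_eq, msp_eq]

/-- `bit` in `ℕ` below the size parameter is `Nat.testBit`. [cite: Buss1986, §2.5] -/
theorem bit_eq_testBit {S a k : ℕ} (hk : k ≤ S.size) :
    BASICModel.bit (M := ℕ) S a k = (a.testBit k).toNat := by
  rw [bit_eq, min_eq_left hk, Nat.testBit_eq_decide_div_mod_eq]
  rcases Nat.mod_two_eq_zero_or_one (a / 2 ^ k) with h | h <;> simp [h]

end NatModel

end Literature.Computability.MetaComplexity
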